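import Summits.NavierStokesRegularity.NavierStokesRegularity.Theorems.AxisymmetricExtremalityAxisymmetricKatoGlobalReduction
import Summits.NavierStokesRegularity.NavierStokesRegularity.Theorems.AxisymmetricExtremalityAxisymmetricKatoGlobalNoSwirlStratum
import Literature.Analysis.FluidPDE.Seregin2022LogSwirlOriginHolds
import HarnessLib

/-!
# Strategist s20-g12 (independent census, family `-s`) — typed companions of STRATEGY-CENSUS-s20-g12.md

Crux: `Theses.AxisymmetricExtremality.AxisymmetricKatoGlobal` (stmt-NavierStokesRegularity-15453).
Nothing here is a route item; everything is sorry-free.  Sections: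

* §1 SUMMIT-DOWN.  The weakest statement the route's `closes` actually consumes in place of the
  crux: `NoAxisymMinimalBlowupDatum` (W₀).  `w0_of_crux`, `closes_of_w0` (pure logic, same proof as
  the route's `closes`), and `w0_of_rhoMaxPure_top` (W₀ is VACUOUS when the pure threshold is `⊤`,
  i.e. it has no positive content short of a regularity theorem).
* §2 DECOMPOSITION D6 (local swirl bound ∧ modulus-from-local-bound), with the kernel-checked
  composition `crux_of_D6` through the landed capstone `AxisymmetricKatoGlobal_of_logSwirlFacts`
  and the PROVED fact `seregin2022_logSwirl_regularAtOrigin_holds`; and `D6_of_crux_informal` is NOT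
  claimed — see the census for why P2 ≡ crux modulo the provable P1 (peeling, not filed).
* §3 ROUTE-LEVEL RIDER.  O(2)-equivariant data are swirl-free (`hasNoSwirl_of_isAxisymmetric_of_reflY`,
  elementary, proved), hence `MinimalDatumO2 → NavierStokesRegularity` by the LANDED no-swirl
  stratum (`closes_of_minimalDatumO2`): running the Smith step with the 2-groups `D_{2^k} ⊂ O(2)`
  removes this crux from the route altogether (tenure territory, recorded for the route planner).
-/

set_option linter.dupNamespace false

noncomputable section

open Set MeasureTheory Filter Topology Function Metric
open scoped ENNReal NNReal
open Literature.Analysis.FluidPDE Literature.Analysis.FunctionSpaces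

namespace Summit.NavierStokesRegularity.NavierStokesRegularity.Cruxes.AxisymmetricKatoGlobal.StrategistS20g12

open Summit.NavierStokesRegularity.NavierStokesRegularity.Theses.AxisymmetricExtremality
open Summit.NavierStokesRegularity.NavierStokesRegularity.Theorems.AxisymmetricKatoGlobal.Registered
open Summit.NavierStokesRegularity.NavierStokesRegularity.Theorems.AxisymmetricKatoGlobal.NoSwirlStratum

local notation "ℝ³" => EuclideanSpace ℝ (Fin 3)
local notation "ℂ³" => EuclideanSpace ℂ (Fin 3)

/-! ## §1 Summit-down: the threshold instance W₀ -/

/-- W₀: there is no axisymmetric Rusin–Šverák minimal blow-up datum (the only instance of the crux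
that `closes` consumes). -/
def NoAxisymMinimalBlowupDatum : Prop :=
  ∀ ν : ℝ, 0 < ν → ∀ (u₀ : ℝ³ → ℝ³) (g : HomSobolev ℝ³ ℂ³ (1 / 2 : ℝ)),
    IsMinimalBlowupDatum ν u₀ g → IsAxisymmetric u₀ → False

/-- crux ⇒ W₀ (trivial specialisation). -/
theorem w0_of_crux (h : AxisymmetricKatoGlobal) : NoAxisymMinimalBlowupDatum := by
  intro ν hν u₀ g hmin hax
  obtain ⟨hL3, hrep, hdiv, -, hnot⟩ := hmin
  exact hnot (h ν hν u₀ g hL3 hrep hdiv (fun θ x => hax θ x))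

/-- The route's deciding theorem needs only W₀ in place of the crux (same pure-logic proof). -/
theorem closes_of_w0 (h₂ : MinimalDatumPFold) (h₄ : PFoldToAxisymmetric)
    (h₀ : NoAxisymMinimalBlowupDatum) : _root_.NavierStokesRegularity := by
  show Literature.NS.NavierStokesExistenceSmoothR3
  intro ν hν u₀ hsm hdiv hdec
  by_contra hno
  obtain ⟨u₁, g, hmin, hax⟩ := h₄ ν hν (h₂ ν hν ⟨u₀, hsm, hdiv, hdec, hno⟩)
  exact h₀ ν hν u₁ g hmin (fun θ x => hax θ x)

/-- W₀ is vacuous when the pure threshold is infinite (no minimal blow-up datum exists at all,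
because `‖g‖ₑ < ⊤`): W₀ carries no content short of a regularity theorem for the class. -/
theorem w0_of_rhoMaxPure_top (h : ∀ ν : ℝ, 0 < ν → rusinSverakRhoMaxPure ν = ⊤) :
    NoAxisymMinimalBlowupDatum := by
  intro ν hν u₀ g hmin _
  obtain ⟨-, -, -, hnorm, -⟩ := hmin
  have hlt : ‖g‖ₑ < ⊤ := enorm_lt_top
  exact hlt.ne (hnorm.trans (h ν hν))

/-- Conversely a finite threshold at some viscosity with W₀ says exactly "minimal data exist and
none is axisymmetric" — W₀ does not decide whether M is empty. (Bookkeeping: W₀ ∧ M ≠ ∅ is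
consistent as far as the tree knows.) -/
theorem w0_iff : NoAxisymMinimalBlowupDatum ↔
    ∀ ν : ℝ, 0 < ν → ∀ (u₀ : ℝ³ → ℝ³) (g : HomSobolev ℝ³ ℂ³ (1 / 2 : ℝ)),
      IsMinimalBlowupDatum ν u₀ g → ¬ IsAxisymmetric u₀ :=
  Iff.rfl

/-! ## §2 Decomposition D6: local boundedness of the swirl ∧ modulus from a local bound -/

/-- P1 (provable layer): along an axisymmetric Kato solution, smooth on `(0,T) × ℝ³`, the swirl
`Γ = x₀u₁ − x₁u₀` stays BOUNDED near the axis uniformly up to the final time `T` (local weak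
maximum principle for the Γ-equation on `{cylRadius ≤ δ₀, |z| ≤ R} × [t₀,T')` with the axis in
the parabolic boundary, lateral data from off-axis boundedness near `T`
(`stub_offAxisBounded_of_localEnergy` + `stub_katoLocalEnergyNearTop`, landed) and far-field data
from `IsKatoSolutionOn.farField_bound_holds`; tools `SwirlMaximumPrinciple.weak_max_principle`,
`swirl_transport_holds`). -/
def LocalSwirlBound : Prop :=
  ∀ ν : ℝ, 0 < ν → ∀ T : ℝ, 0 < T → ∀ (u₀ : ℝ³ → ℝ³) (g : HomSobolev ℝ³ ℂ³ (1 / 2 : ℝ))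
    (u : ℝ → ℝ³ → ℝ³), g.Represents (Literature.Analysis.FunctionSpaces.EuclideanSpace.complexify ∘ u₀) →
    IsKatoSolutionOn T ν u₀ u → ContDiffOn ℝ (⊤ : ℕ∞) (uncurry u) (Ioo 0 T ×ˢ univ) →
    (∀ t ∈ Ioo 0 T, IsAxisymmetric (u t)) →
    ∀ t₀ ∈ Ioo 0 T, ∃ C δ₀ : ℝ, 0 < δ₀ ∧ δ₀ < 1 ∧
      ∀ t ∈ Ico t₀ T, ∀ x : ℝ³, cylRadius x ≤ δ₀ → |swirl (u t) x| ≤ C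

/-- P2 (the open layer = ns.S25 localised): a swirl bounded near the axis up to `T` acquires the
logarithmic modulus `|Γ| ≤ C'/|log r|³` near the axis uniformly up to `T`. -/
def ModulusOfLocalBound : Prop :=
  ∀ ν : ℝ, 0 < ν → ∀ T : ℝ, 0 < T → ∀ (u₀ : ℝ³ → ℝ³) (g : HomSobolev ℝ³ ℂ³ (1 / 2 : ℝ))
    (u : ℝ → ℝ³ → ℝ³), g.Represents (Literature.Analysis.FunctionSpaces.EuclideanSpace.complexify ∘ u₀) →
    IsKatoSolutionOn T ν u₀ u → ContDiffOn ℝ (⊤ : ℕ∞) (uncurry u) (Ioo 0 T ×ˢ univ) →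
    (∀ t ∈ Ioo 0 T, IsAxisymmetric (u t)) →
    ∀ t₀ ∈ Ioo 0 T, ∀ C δ₀ : ℝ, 0 < δ₀ → δ₀ < 1 →
      (∀ t ∈ Ico t₀ T, ∀ x : ℝ³, cylRadius x ≤ δ₀ → |swirl (u t) x| ≤ C) →
      ∃ C' δ₁ : ℝ, 0 < δ₁ ∧ δ₁ < 1 ∧
        ∀ t ∈ Ico t₀ T, ∀ x : ℝ³, cylRadius x ≤ δ₁ →
          |swirl (u t) x| ≤ C' / |Real.log (cylRadius x)| ^ 3

/-- D6 composition (kernel-checked): P1 → P2 → crux, through the landed capstone and the proved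
Seregin 2022 origin criterion. -/
theorem crux_of_D6 (h₁ : LocalSwirlBound) (h₂ : ModulusOfLocalBound) : AxisymmetricKatoGlobal :=
  AxisymmetricKatoGlobal_of_logSwirlFacts
    Literature.Analysis.FluidPDE.seregin2022_logSwirl_regularAtOrigin_holds
    (fun ν hν T hT u₀ g u hrep hK hsm hax t₀ ht₀ => by
      obtain ⟨C, δ₀, hδ₀, hδ₁, hb⟩ := h₁ ν hν T hT u₀ g u hrep hK hsm hax t₀ ht₀
      exact h₂ ν hν T hT u₀ g u hrep hK hsm hax t₀ ht₀ C δ₀ hδ₀ hδ₁ hb)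

/-! ## §3 Route-level rider: O(2)-symmetric minimal data are swirl-free, so the crux is avoidable -/

/-- Reflection in the plane `{x₁ = 0}` (a plane containing the symmetry axis). -/
def reflY (x : ℝ³) : ℝ³ := WithLp.toLp 2 ![x 0, -x 1, x 2]

@[simp] theorem reflY_apply_zero (x : ℝ³) : reflY x 0 = x 0 := rfl
@[simp] theorem reflY_apply_one (x : ℝ³) : reflY x 1 = -x 1 := rfl
@[simp] theorem reflY_apply_two (x : ℝ³) : reflY x 2 = x 2 := rfl

/-- The swirl is ODD under a reflection-equivariant field: `Γ(Sx) = −Γ(x)`. -/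
theorem swirl_reflY (u : ℝ³ → ℝ³) (hS : ∀ x, u (reflY x) = reflY (u x)) (x : ℝ³) :
    swirl u (reflY x) = -swirl u x := by
  simp only [swirl, hS, reflY_apply_zero, reflY_apply_one]
  ring

/-- Off the axis, the reflected point `Sx` is a rotation `R_θ x` of `x` (θ = −2·azimuth). -/
theorem exists_rotZ_eq_reflY (x : ℝ³) (hx : cylRadius x ≠ 0) : ∃ θ : ℝ, rotZ θ x = reflY x := by
  set ρ : ℝ := x 0 ^ 2 + x 1 ^ 2 with hρ
  have hρpos : 0 < ρ := by
    have h := cylRadius_sq x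
    have hne : cylRadius x ^ 2 ≠ 0 := pow_ne_zero 2 hx
    rw [hρ, ← h]
    exact lt_of_le_of_ne (sq_nonneg _) (Ne.symm hne)
  set w : ℂ := ⟨x 0 ^ 2 - x 1 ^ 2, -2 * x 0 * x 1⟩ with hw
  have hnorm : ‖w‖ = ρ := by
    have h2 : ‖w‖ ^ 2 = ρ ^ 2 := by
      rw [Complex.sq_norm, Complex.normSq_mk, hρ]
      ring
    exact (pow_left_inj₀ (norm_nonneg _) hρpos.le two_ne_zero).1 h2
  refine ⟨Complex.arg w, ?_⟩
  have hc : ρ * Real.cos (Complex.arg w) = x 0 ^ 2 - x 1 ^ 2 := by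
    have := Complex.norm_mul_cos_arg w
    rw [hnorm] at this
    simpa [hw] using this
  have hs : ρ * Real.sin (Complex.arg w) = -2 * x 0 * x 1 := by
    have := Complex.norm_mul_sin_arg w
    rw [hnorm] at this
    simpa [hw] using this
  ext i
  fin_cases i
  · show rotZ (Complex.arg w) x 0 = reflY x 0
    rw [rotZ_apply_zero, reflY_apply_zero]
    have key : ρ * (Real.cos (Complex.arg w) * x 0 - Real.sin (Complex.arg w) * x 1) = ρ * x 0 := by
      linear_combination x 0 * hc - x 1 * hs
    exact mul_left_cancel₀ hρpos.ne' key
  · show rotZ (Complex.arg w) x 1 = reflY x 1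
    rw [rotZ_apply_one, reflY_apply_one]
    have key : ρ * (Real.sin (Complex.arg w) * x 0 + Real.cos (Complex.arg w) * x 1) = ρ * (-x 1) := by
      linear_combination x 0 * hs + x 1 * hc
    exact mul_left_cancel₀ hρpos.ne' key
  · show rotZ (Complex.arg w) x 2 = reflY x 2
    rw [rotZ_apply_two, reflY_apply_two]

/-- **O(2)-equivariant fields have no swirl**: axisymmetric and reflection-equivariant ⇒ `Γ ≡ 0`
(Γ is rotation-invariant and reflection-odd, and `Sx` is a rotation of `x`). -/
theorem hasNoSwirl_of_isAxisymmetric_of_reflY {u : ℝ³ → ℝ³} (hax : IsAxisymmetric u)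
    (hS : ∀ x, u (reflY x) = reflY (u x)) : HasNoSwirl u := by
  intro x
  by_cases hx : cylRadius x = 0
  · exact swirl_eq_zero_of_cylRadius_eq_zero u hx
  obtain ⟨θ, hθ⟩ := exists_rotZ_eq_reflY x hx
  have h1 : swirl u (reflY x) = swirl u x := by rw [← hθ]; exact hax.swirl_rotZ θ x
  have h2 := swirl_reflY u hS x
  linarith

/-- R1 (route-level replacement of AXB ∧ AX_H): if Clay (A) fails at viscosity ν, SOME minimal
blow-up datum is O(2)-symmetric (axisymmetric about the x₂-axis AND equivariant under the
reflection in a plane containing it) — the fixed-point output of Smith theory for the 2-GROUPS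
`D_{2^k} ⊂ O(2)` (F₂-acyclicity of M̂ only), nested fixed sets, and the Sim-cocycle lift. -/
def MinimalDatumO2 : Prop :=
  ∀ ν : ℝ, 0 < ν → (∃ v₀ : ℝ³ → ℝ³, ContDiff ℝ (⊤ : ℕ∞) v₀ ∧
      Literature.Analysis.FluidPDE.NSWave0.IsDivFree v₀ ∧ Literature.Analysis.FluidPDE.HasRapidSpatialDecay v₀ ∧
      ¬ ∃ (u : ℝ → ℝ³ → ℝ³) (p : ℝ → ℝ³ → ℝ), Literature.Analysis.FluidPDE.IsSmoothOnHalfSpace u ∧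
        Literature.Analysis.FluidPDE.IsSmoothOnHalfSpace p ∧
        Literature.Analysis.FluidPDE.IsNavierStokesSolution ν 0 v₀ u p ∧
        Literature.Analysis.FluidPDE.HasBoundedEnergy u) →
    ∃ (u₀ : ℝ³ → ℝ³) (g : HomSobolev ℝ³ ℂ³ (1 / 2 : ℝ)),
      IsMinimalBlowupDatum ν u₀ g ∧ IsAxisymmetric u₀ ∧ ∀ x, u₀ (reflY x) = reflY (u₀ x)

/-- **The rider closes the summit WITHOUT the crux**: O(2)-symmetric minimal data are swirl-free,
and the swirl-free stratum of the crux is LANDED (`axisymmetricKatoGlobal_noSwirl_stratum`). -/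
theorem closes_of_minimalDatumO2 (h : MinimalDatumO2) : _root_.NavierStokesRegularity := by
  show Literature.NS.NavierStokesExistenceSmoothR3
  intro ν hν u₀ hsm hdiv hdec
  by_contra hno
  obtain ⟨u₁, g, ⟨hL3, -, hdiv₁, -, hnot⟩, hax, hS⟩ := h ν hν ⟨u₀, hsm, hdiv, hdec, hno⟩
  exact hnot (axisymmetricKatoGlobal_noSwirl_stratum ν hν u₁ hL3 hdiv₁ (fun θ x => hax θ x)
    (hasNoSwirl_of_isAxisymmetric_of_reflY hax hS))

/-- The O(2) instance of the crux itself is a THEOREM (the crux restricted to reflection-equivariant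
data), recorded as the exact "solved stratum" the census refers to. -/
theorem crux_O2_stratum : ∀ ν : ℝ, 0 < ν → ∀ (u₀ : ℝ³ → ℝ³) (g : HomSobolev ℝ³ ℂ³ (1 / 2 : ℝ)),
    MemLp u₀ 3 volume → g.Represents (Literature.Analysis.FunctionSpaces.EuclideanSpace.complexify ∘ u₀) →
    IsWeaklyDivFree u₀ → IsAxisymmetric u₀ → (∀ x, u₀ (reflY x) = reflY (u₀ x)) →
    HasGlobalKatoSolution ν u₀ :=
  fun ν hν u₀ _ hL3 _ hdiv hax hS =>
    axisymmetricKatoGlobal_noSwirl_stratum ν hν u₀ hL3 hdiv (fun θ x => hax θ x)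
      (hasNoSwirl_of_isAxisymmetric_of_reflY hax hS)

end Summit.NavierStokesRegularity.NavierStokesRegularity.Cruxes.AxisymmetricKatoGlobal.StrategistS20g12

end
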